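import Literature.AlgebraicGeometry.AbelianSchemes.InfinitesimalPointDifferenceSections
import Literature.AlgebraicGeometry.Deformation.FirstOrderDifferenceLocality
import Literature.AlgebraicGeometry.Deformation.FirstOrderDifferenceCocycleRelations
import Mathlib.AlgebraicGeometry.Morphisms.Affine
import HarnessLib

/-!
# Differences along `1_X × k_j` vs `1_X × k₀` on ALL sections of `X ×_S X`: homogeneity and additivity, and the induced
# relations on Čech cocycles of units and on `H¹(𝓘)` (the (Mc) N3′ S-e brick K3 of cell hodgecm-mathlib)

Topic `Literature/AlgebraicGeometry/AbelianSchemes`; namespace `Literature.AlgebraicGeometry.AbelianSchemes.Over` (stated for an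
arbitrary `X : Over S` over an affine `S` — no group structure is used).  THEOREMS ONLY (no definition, no named fact, no
instance, no notation, no `sorry`).

THE PRINT.  [MumfordAV1970] §13, proof of the Theorem (pp. 125–127): the liftings `k_j : T → X` of a `T₀`-point along a first-order
thickening `T₀ ↪ T` move the pulled-back cocycle of a line bundle on `X × X` by «`Σ aᵢ ⊗ D(bᵢ)` on the product neighbourhoods
`Uᵢ × V`», which is additive and homogeneous in the derivation `D`; hence the map «lifting ↦ class in `H¹(𝓘)`» is linear.  The
sibling file `InfinitesimalPointDifferenceSections` (B-p10 (g14)) proves the sectionwise relations on the PRODUCT-AFFINE opens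
`pr₁⁻¹P₁ ∩ pr₂⁻¹P₂`; since these are not a basis of the topology of `X ×_S X`, the present file transports them to ALL sections
over ALL opens by the locality theorem of `Deformation/FirstOrderDifferenceLocality` ([Hartshorne2010] §6: the differences
`(1 × k_j)♯ − (1 × k₀)♯` are `𝓘`-valued derivations, `𝓘² = 0`), and then to the transition functions of any Čech cocycle of
units on `X ×_S X` and to the classes in `H¹(X ×_S T, 𝓘)` ([Hartshorne1977] III Ex. 4.4–4.5; tree-bound
`Deformation/FirstOrderPairUnitsClassShift`, `Deformation/FirstOrderDifferenceCocycleRelations`).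

* §1 `isAffineOpen_fst_inf_snd` — `pr₁⁻¹P₁ ∩ pr₂⁻¹P₂ ⊆ X₁ ×_S X₂` is an affine open for `S`, `P₁`, `P₂` affine (Mathlib
  `Scheme.Hom.isPullback_resLE`, [GortzWedhorn2020] Prop. 4.20, [StacksProject] Tag 01JO).
* §2 **`appLE_whiskerLeft_sub_eq_mul_sub_forall`** ∕ **`appLE_whiskerLeft_sub_eq_add_sub_forall`** — for `T₀ → T` over `S` with
  `1_X × ι₀` a first-order thickening, `T`-points `k_j` agreeing on `T₀` and landing in an affine open `P₂ ⊆ X`, and the chart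
  relations `k₂♯ − k₀♯ = μ (k₁♯ − k₀♯)` (resp. `k₃♯ − k₀♯ = (k₁♯ − k₀♯) + (k₂♯ − k₀♯)`) on `Γ(X, P₂)`: the same relation between
  `(1 × k_j)♯ g − (1 × k₀)♯ g` for EVERY open `U ⊆ X ×_S X`, EVERY `g ∈ Γ(U)`, EVERY `V ⊆ X ×_S T` below the preimages.
* §3 `pullback_whiskerLeft_g_sub_eq_mul_sub` ∕ `pullback_whiskerLeft_g_sub_eq_add_sub` — the same for all transition functions
  of `(1 × k_j)^*c`, `c` any Čech cocycle of units on `X ×_S X` (the `hprop` binders of the class statements).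
* the CLASS statements (`H¹(𝓘)`-level homogeneity ∕ additivity, sections and chart form) are in the sequel
  `AbelianSchemes/InfinitesimalPointDifferenceClassShifts`.

Cell hodgecm-mathlib (D-0151 ∕ FLOOR 0), P1 (Mc) N3′ S-e, brick K3; author F0P1c-p03 (g0).  PROOF lane, generic capital.  HC_CM is proved
only modulo the 7 printed citations until rung 0 closes; nothing here is about HC.

## References
* [MumfordAV1970] D. Mumford, *Abelian Varieties* (1970): §13, proof of the Theorem, pp. 125–127.
* [Hartshorne2010] R. Hartshorne, *Deformation Theory*, GTM 257 (2010), §6, proof of Thm. 6.4 (pp. 50–51).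
* [Hartshorne1977] R. Hartshorne, *Algebraic Geometry* (1977), III §4, Ex. 4.4 (b), Ex. 4.5.
* [GortzWedhorn2020] U. Görtz, T. Wedhorn, *Algebraic Geometry I*, 2nd ed. (2020): Prop. 4.20.
* [StacksProject] The Stacks Project, Tag 01JO.
-/

universe u

open CategoryTheory CategoryTheory.Limits Opposite TopologicalSpace AlgebraicGeometry MonoidalCategory
  CartesianMonoidalCategory

noncomputable section

namespace Literature.AlgebraicGeometry.AbelianSchemes.Over

open Literature.AlgebraicGeometry.Deformation Literature.AlgebraicGeometry.Modules Literature.AlgebraicGeometry.Motives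

/-! ## §1 Product-affine opens are affine -/

/-- **`pr₁⁻¹P₁ ∩ pr₂⁻¹P₂ ⊆ X₁ ×_S X₂` is an affine open** for `S` affine and `P₁ ⊆ X₁`, `P₂ ⊆ X₂` affine opens: it is
`P₁ ×_S P₂` (Mathlib `Scheme.Hom.isPullback_resLE`), a fibre product of affine schemes. [cite: GortzWedhorn2020, Prop. 4.20]
[cite: StacksProject, Tag 01JO] -/
theorem isAffineOpen_fst_inf_snd {S : Scheme.{u}} [IsAffine S] (X₁ X₂ : Over S) {P₁ : X₁.left.Opens}
    {P₂ : X₂.left.Opens} (hP₁ : IsAffineOpen P₁) (hP₂ : IsAffineOpen P₂) :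
    IsAffineOpen ((fst X₁ X₂).left ⁻¹ᵁ P₁ ⊓ (snd X₁ X₂).left ⁻¹ᵁ P₂) := by
  have H : IsPullback (fst X₁ X₂).left (snd X₁ X₂).left X₁.hom X₂.hom :=
    IsPullback.of_hasPullback X₁.hom X₂.hom
  have : IsAffine _ := hP₁
  have : IsAffine _ := hP₂
  have : IsAffine _ := isAffineOpen_top S
  exact IsAffine.of_isPullback
    (Scheme.Hom.isPullback_resLE H (US := ⊤) (UT := P₂) (UX := P₁) le_top le_top
      (UY := (fst X₁ X₂).left ⁻¹ᵁ P₁ ⊓ (snd X₁ X₂).left ⁻¹ᵁ P₂) rfl)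

/-! ## §2 The relations for all sections over all opens of `X ×_S X` -/

section Forall

variable {S : Scheme.{u}} [IsAffine S] (X T₀ T : Over S) (ι₀ : T₀ ⟶ T) [IsFirstOrderThickening (X ◁ ι₀).left]

omit [IsAffine S] [IsFirstOrderThickening (X ◁ ι₀).left] in
/-- `1_X × k_j` agrees with `1_X × k₀` on the thickening `1_X × ι₀` when `k_j` agrees with `k₀` on `T₀`. [cite: MumfordAV1970, §13 (proof of the Thm. pp. 125–127)] -/
theorem whiskerLeft_left_comp_eq_of_comp_eq {k₀ k : T ⟶ X} (hk : ι₀ ≫ k = ι₀ ≫ k₀) :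
    (X ◁ ι₀).left ≫ (X ◁ k).left = (X ◁ ι₀).left ≫ (X ◁ k₀).left := by
  rw [← Over.comp_left, ← Over.comp_left, ← MonoidalCategory.whiskerLeft_comp, ← MonoidalCategory.whiskerLeft_comp, hk]

omit [IsAffine S] in
/-- Every point of `X ×_S T` lies in `pr₁⁻¹P₁` for some affine open `P₁ ⊆ X`. [cite: StacksProject, Tag 01JO] -/
theorem exists_mem_fst_preimage_affineOpens (x : ↥(X ⊗ T).left) :
    ∃ P₁ : X.left.affineOpens, x ∈ (fst X T).left ⁻¹ᵁ (P₁ : X.left.Opens) := by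
  obtain ⟨P, hP, hxP, -⟩ := (Opens.isBasis_iff_nbhd.mp X.left.isBasis_affineOpens)
    (show (fst X T).left.base x ∈ (⊤ : X.left.Opens) from trivial)
  exact ⟨⟨P, hP⟩, hxP⟩

/-- **HOMOGENEITY ON ALL SECTIONS.**  `S` affine, `ι₀ : T₀ → T` over `S` with `1_X × ι₀` a first-order thickening, `T`-points
`k₀ k₁ k₂ : T → X` over `S` agreeing on `T₀` and landing in the affine open `P₂ ⊆ X` (`k_j⁻¹P₂ = ⊤`), a scalar `μ ∈ Γ(T, 𝒪_T)` with
`k₂♯ g − k₀♯ g = μ (k₁♯ g − k₀♯ g)` for all `g ∈ Γ(X, P₂)`.  Then for EVERY open `U ⊆ X ×_S X`, EVERY `g ∈ Γ(X ×_S X, U)` and EVERY open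
`V ⊆ X ×_S T` below the three preimages: `(1×k₂)♯ g|_V − (1×k₀)♯ g|_V = pr₂♯(μ)|_V · ((1×k₁)♯ g|_V − (1×k₀)♯ g|_V)` — the
sectionwise relation on the product-affine opens `pr₁⁻¹P₁ ∩ pr₂⁻¹P₂` (sibling file) localised by
`Deformation.appLE_sub_eq_mul_sub_of_forall_affineOpen`. [cite: MumfordAV1970, §13 (proof of the Thm. pp. 125–127)]
[cite: Hartshorne2010, §6 proof of Thm. 6.4, pp. 50–51] -/
theorem appLE_whiskerLeft_sub_eq_mul_sub_forall (k₀ k₁ k₂ : T ⟶ X) (hk₁ : ι₀ ≫ k₁ = ι₀ ≫ k₀)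
    (hk₂ : ι₀ ≫ k₂ = ι₀ ≫ k₀) {P₂ : X.left.Opens} (hP₂ : IsAffineOpen P₂)
    (hk₀P : k₀.left ⁻¹ᵁ P₂ = ⊤) (hk₁P : k₁.left ⁻¹ᵁ P₂ = ⊤) (hk₂P : k₂.left ⁻¹ᵁ P₂ = ⊤) (μ : Γ(T.left, ⊤))
    (hψ : ∀ g : Γ(X.left, P₂),
      (k₂.left.appLE P₂ ⊤ hk₂P.ge).hom g - (k₀.left.appLE P₂ ⊤ hk₀P.ge).hom g =
        μ * ((k₁.left.appLE P₂ ⊤ hk₁P.ge).hom g - (k₀.left.appLE P₂ ⊤ hk₀P.ge).hom g))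
    (U : (X ⊗ X).left.Opens) (g : Γ((X ⊗ X).left, U)) (V : (X ⊗ T).left.Opens)
    (h₀ : V ≤ (X ◁ k₀).left ⁻¹ᵁ U) (h₁ : V ≤ (X ◁ k₁).left ⁻¹ᵁ U) (h₂ : V ≤ (X ◁ k₂).left ⁻¹ᵁ U) :
    ((X ◁ k₂).left.appLE U V h₂).hom g - ((X ◁ k₀).left.appLE U V h₀).hom g =
      ((snd X T).left.appLE ⊤ V le_top).hom μ *
        (((X ◁ k₁).left.appLE U V h₁).hom g - ((X ◁ k₀).left.appLE U V h₀).hom g) := by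
  have e : secRes (X ⊗ T).left (le_top : V ≤ ⊤) (((snd X T).left.appLE ⊤ ⊤ le_top).hom μ) =
      ((snd X T).left.appLE ⊤ V le_top).hom μ := by
    change ((snd X T).left.appLE ⊤ ⊤ le_top ≫ (X ⊗ T).left.presheaf.map (homOfLE le_top).op) μ = _
    rw [Scheme.Hom.appLE_map]
  rw [← e]
  refine appLE_sub_eq_mul_sub_of_forall_affineOpen (X ◁ ι₀).left (X ◁ k₀).left (X ◁ k₁).left (X ◁ k₂).left
    (whiskerLeft_left_comp_eq_of_comp_eq X T₀ T ι₀ hk₁) (whiskerLeft_left_comp_eq_of_comp_eq X T₀ T ι₀ hk₂)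
    (((snd X T).left.appLE ⊤ ⊤ le_top).hom μ)
    (fun P₁ : X.left.affineOpens => (fst X X).left ⁻¹ᵁ (P₁ : X.left.Opens) ⊓ (snd X X).left ⁻¹ᵁ P₂)
    (fun P₁ => isAffineOpen_fst_inf_snd X X P₁.2 hP₂)
    (fun P₁ : X.left.affineOpens => (fst X T).left ⁻¹ᵁ (P₁ : X.left.Opens))
    (fun _ => le_preimage_whiskerLeft_left X T k₀ hk₀P rfl rfl)
    (fun _ => le_preimage_whiskerLeft_left X T k₁ hk₁P rfl rfl)
    (fun _ => le_preimage_whiskerLeft_left X T k₂ hk₂P rfl rfl)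
    (exists_mem_fst_preimage_affineOpens X T) (fun P₁ s => ?_) U g V h₀ h₁ h₂
  have e' : secRes (X ⊗ T).left (le_top : (fst X T).left ⁻¹ᵁ (P₁ : X.left.Opens) ≤ ⊤)
      (((snd X T).left.appLE ⊤ ⊤ le_top).hom μ) =
      ((snd X T).left.appLE ⊤ ((fst X T).left ⁻¹ᵁ (P₁ : X.left.Opens)) le_top).hom μ := by
    change ((snd X T).left.appLE ⊤ ⊤ le_top ≫ (X ⊗ T).left.presheaf.map (homOfLE le_top).op) μ = _
    rw [Scheme.Hom.appLE_map]
  rw [e']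
  exact appLE_whiskerLeft_sub_eq_mul_sub_of_sections X T k₀ k₁ k₂ P₁.2 hP₂ hk₀P hk₁P hk₂P μ hψ rfl rfl _ _ _ s

/-- **ADDITIVITY ON ALL SECTIONS.**  Same setting with four `T`-points `k₀ … k₃` agreeing on `T₀`, landing in the affine `P₂`, and
`k₃♯ g − k₀♯ g = (k₁♯ g − k₀♯ g) + (k₂♯ g − k₀♯ g)` on `Γ(X, P₂)`: then for EVERY `U`, `g ∈ Γ(X ×_S X, U)`, `V`:
`(1×k₃)♯ g − (1×k₀)♯ g = ((1×k₁)♯ g − (1×k₀)♯ g) + ((1×k₂)♯ g − (1×k₀)♯ g)` on `V`.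
[cite: MumfordAV1970, §13 (proof of the Thm. pp. 125–127)] [cite: Hartshorne2010, §6 proof of Thm. 6.4, pp. 50–51] -/
theorem appLE_whiskerLeft_sub_eq_add_sub_forall (k₀ k₁ k₂ k₃ : T ⟶ X) (hk₁ : ι₀ ≫ k₁ = ι₀ ≫ k₀)
    (hk₂ : ι₀ ≫ k₂ = ι₀ ≫ k₀) (hk₃ : ι₀ ≫ k₃ = ι₀ ≫ k₀) {P₂ : X.left.Opens} (hP₂ : IsAffineOpen P₂)
    (hk₀P : k₀.left ⁻¹ᵁ P₂ = ⊤) (hk₁P : k₁.left ⁻¹ᵁ P₂ = ⊤) (hk₂P : k₂.left ⁻¹ᵁ P₂ = ⊤) (hk₃P : k₃.left ⁻¹ᵁ P₂ = ⊤)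
    (hψ : ∀ g : Γ(X.left, P₂),
      (k₃.left.appLE P₂ ⊤ hk₃P.ge).hom g - (k₀.left.appLE P₂ ⊤ hk₀P.ge).hom g =
        ((k₁.left.appLE P₂ ⊤ hk₁P.ge).hom g - (k₀.left.appLE P₂ ⊤ hk₀P.ge).hom g) +
          ((k₂.left.appLE P₂ ⊤ hk₂P.ge).hom g - (k₀.left.appLE P₂ ⊤ hk₀P.ge).hom g))
    (U : (X ⊗ X).left.Opens) (g : Γ((X ⊗ X).left, U)) (V : (X ⊗ T).left.Opens)
    (h₀ : V ≤ (X ◁ k₀).left ⁻¹ᵁ U) (h₁ : V ≤ (X ◁ k₁).left ⁻¹ᵁ U) (h₂ : V ≤ (X ◁ k₂).left ⁻¹ᵁ U)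
    (h₃ : V ≤ (X ◁ k₃).left ⁻¹ᵁ U) :
    ((X ◁ k₃).left.appLE U V h₃).hom g - ((X ◁ k₀).left.appLE U V h₀).hom g =
      (((X ◁ k₁).left.appLE U V h₁).hom g - ((X ◁ k₀).left.appLE U V h₀).hom g) +
        (((X ◁ k₂).left.appLE U V h₂).hom g - ((X ◁ k₀).left.appLE U V h₀).hom g) :=
  appLE_sub_eq_add_sub_of_forall_affineOpen (X ◁ ι₀).left (X ◁ k₀).left (X ◁ k₁).left (X ◁ k₂).left (X ◁ k₃).left
    (whiskerLeft_left_comp_eq_of_comp_eq X T₀ T ι₀ hk₁) (whiskerLeft_left_comp_eq_of_comp_eq X T₀ T ι₀ hk₂)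
    (whiskerLeft_left_comp_eq_of_comp_eq X T₀ T ι₀ hk₃)
    (fun P₁ : X.left.affineOpens => (fst X X).left ⁻¹ᵁ (P₁ : X.left.Opens) ⊓ (snd X X).left ⁻¹ᵁ P₂)
    (fun P₁ => isAffineOpen_fst_inf_snd X X P₁.2 hP₂)
    (fun P₁ : X.left.affineOpens => (fst X T).left ⁻¹ᵁ (P₁ : X.left.Opens))
    (fun _ => le_preimage_whiskerLeft_left X T k₀ hk₀P rfl rfl)
    (fun _ => le_preimage_whiskerLeft_left X T k₁ hk₁P rfl rfl)
    (fun _ => le_preimage_whiskerLeft_left X T k₂ hk₂P rfl rfl)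
    (fun _ => le_preimage_whiskerLeft_left X T k₃ hk₃P rfl rfl)
    (exists_mem_fst_preimage_affineOpens X T)
    (fun P₁ s => appLE_whiskerLeft_sub_eq_add_sub_of_sections X T k₀ k₁ k₂ k₃ P₁.2 hP₂ hk₀P hk₁P hk₂P hk₃P hψ rfl rfl
      _ _ _ _ s)
    U g V h₀ h₁ h₂ h₃

/-! ## §3 The relations for all transition functions of pulled-back Čech cocycles of units -/

/-- **HOMOGENEITY ON TRANSITION FUNCTIONS.**  In the setting of `appLE_whiskerLeft_sub_eq_mul_sub_forall`, for every Čech cocycle of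
units `c` on `X ×_S X`, the transition functions of the pulled-back cocycles `(1 × k_j)^*c` satisfy
`((1×k₂)^*c)_{ab} − ((1×k₀)^*c)_{ab} = pr₂♯(μ)|_V · (((1×k₁)^*c)_{ab} − ((1×k₀)^*c)_{ab})` on every `V` — the hypothesis `hprop` of the
tree-bound `Deformation.cechToH_eq_map_of_sub_eq_mul_sub`. [cite: MumfordAV1970, §13 (proof of the Thm. pp. 125–127)]
[cite: Hartshorne1977, III Ex. 4.5] -/
theorem pullback_whiskerLeft_g_sub_eq_mul_sub (k₀ k₁ k₂ : T ⟶ X) (hk₁ : ι₀ ≫ k₁ = ι₀ ≫ k₀)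
    (hk₂ : ι₀ ≫ k₂ = ι₀ ≫ k₀) {P₂ : X.left.Opens} (hP₂ : IsAffineOpen P₂)
    (hk₀P : k₀.left ⁻¹ᵁ P₂ = ⊤) (hk₁P : k₁.left ⁻¹ᵁ P₂ = ⊤) (hk₂P : k₂.left ⁻¹ᵁ P₂ = ⊤) (μ : Γ(T.left, ⊤))
    (hψ : ∀ g : Γ(X.left, P₂),
      (k₂.left.appLE P₂ ⊤ hk₂P.ge).hom g - (k₀.left.appLE P₂ ⊤ hk₀P.ge).hom g =
        μ * ((k₁.left.appLE P₂ ⊤ hk₁P.ge).hom g - (k₀.left.appLE P₂ ⊤ hk₀P.ge).hom g))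
    (c : UnitCocycle (X ⊗ X).left) (a b : ↥(X ⊗ T).left) (V : (X ⊗ T).left.Opens)
    (h₀a : V ≤ (UnitCocycle.pullback (X ◁ k₀).left c).U a) (h₀b : V ≤ (UnitCocycle.pullback (X ◁ k₀).left c).U b)
    (h₁a : V ≤ (UnitCocycle.pullback (X ◁ k₁).left c).U a) (h₁b : V ≤ (UnitCocycle.pullback (X ◁ k₁).left c).U b)
    (h₂a : V ≤ (UnitCocycle.pullback (X ◁ k₂).left c).U a) (h₂b : V ≤ (UnitCocycle.pullback (X ◁ k₂).left c).U b) :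
    (UnitCocycle.pullback (X ◁ k₂).left c).g a b V h₂a h₂b - (UnitCocycle.pullback (X ◁ k₀).left c).g a b V h₀a h₀b =
      secRes (X ⊗ T).left (le_top : V ≤ ⊤) (((snd X T).left.appLE ⊤ ⊤ le_top).hom μ) *
        ((UnitCocycle.pullback (X ◁ k₁).left c).g a b V h₁a h₁b -
          (UnitCocycle.pullback (X ◁ k₀).left c).g a b V h₀a h₀b) := by
  refine UnitCocycle.pullback_g_sub_eq_mul_sub_of_forall_appLE (X ◁ ι₀).left (X ◁ k₀).left (X ◁ k₁).left
    (X ◁ k₂).left (whiskerLeft_left_comp_eq_of_comp_eq X T₀ T ι₀ hk₁) (whiskerLeft_left_comp_eq_of_comp_eq X T₀ T ι₀ hk₂)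
    _ (fun U g V h₀ h₁ h₂ => ?_) c a b V h₀a h₀b h₁a h₁b h₂a h₂b
  have e : secRes (X ⊗ T).left (le_top : V ≤ ⊤) (((snd X T).left.appLE ⊤ ⊤ le_top).hom μ) =
      ((snd X T).left.appLE ⊤ V le_top).hom μ := by
    change ((snd X T).left.appLE ⊤ ⊤ le_top ≫ (X ⊗ T).left.presheaf.map (homOfLE le_top).op) μ = _
    rw [Scheme.Hom.appLE_map]
  rw [e]
  exact appLE_whiskerLeft_sub_eq_mul_sub_forall X T₀ T ι₀ k₀ k₁ k₂ hk₁ hk₂ hP₂ hk₀P hk₁P hk₂P μ hψ U g V h₀ h₁ h₂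

/-- **ADDITIVITY ON TRANSITION FUNCTIONS.**  In the setting of `appLE_whiskerLeft_sub_eq_add_sub_forall`, for every Čech cocycle of units
`c` on `X ×_S X`: `((1×k₃)^*c)_{ab} − ((1×k₀)^*c)_{ab} = (((1×k₁)^*c)_{ab} − ((1×k₀)^*c)_{ab}) + (((1×k₂)^*c)_{ab} − ((1×k₀)^*c)_{ab})` on
every `V`. [cite: MumfordAV1970, §13 (proof of the Thm. pp. 125–127)] [cite: Hartshorne1977, III Ex. 4.5] -/
theorem pullback_whiskerLeft_g_sub_eq_add_sub (k₀ k₁ k₂ k₃ : T ⟶ X) (hk₁ : ι₀ ≫ k₁ = ι₀ ≫ k₀)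
    (hk₂ : ι₀ ≫ k₂ = ι₀ ≫ k₀) (hk₃ : ι₀ ≫ k₃ = ι₀ ≫ k₀) {P₂ : X.left.Opens} (hP₂ : IsAffineOpen P₂)
    (hk₀P : k₀.left ⁻¹ᵁ P₂ = ⊤) (hk₁P : k₁.left ⁻¹ᵁ P₂ = ⊤) (hk₂P : k₂.left ⁻¹ᵁ P₂ = ⊤) (hk₃P : k₃.left ⁻¹ᵁ P₂ = ⊤)
    (hψ : ∀ g : Γ(X.left, P₂),
      (k₃.left.appLE P₂ ⊤ hk₃P.ge).hom g - (k₀.left.appLE P₂ ⊤ hk₀P.ge).hom g =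
        ((k₁.left.appLE P₂ ⊤ hk₁P.ge).hom g - (k₀.left.appLE P₂ ⊤ hk₀P.ge).hom g) +
          ((k₂.left.appLE P₂ ⊤ hk₂P.ge).hom g - (k₀.left.appLE P₂ ⊤ hk₀P.ge).hom g))
    (c : UnitCocycle (X ⊗ X).left) (a b : ↥(X ⊗ T).left) (V : (X ⊗ T).left.Opens)
    (h₀a : V ≤ (UnitCocycle.pullback (X ◁ k₀).left c).U a) (h₀b : V ≤ (UnitCocycle.pullback (X ◁ k₀).left c).U b)
    (h₁a : V ≤ (UnitCocycle.pullback (X ◁ k₁).left c).U a) (h₁b : V ≤ (UnitCocycle.pullback (X ◁ k₁).left c).U b)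
    (h₂a : V ≤ (UnitCocycle.pullback (X ◁ k₂).left c).U a) (h₂b : V ≤ (UnitCocycle.pullback (X ◁ k₂).left c).U b)
    (h₃a : V ≤ (UnitCocycle.pullback (X ◁ k₃).left c).U a) (h₃b : V ≤ (UnitCocycle.pullback (X ◁ k₃).left c).U b) :
    (UnitCocycle.pullback (X ◁ k₃).left c).g a b V h₃a h₃b - (UnitCocycle.pullback (X ◁ k₀).left c).g a b V h₀a h₀b =
      ((UnitCocycle.pullback (X ◁ k₁).left c).g a b V h₁a h₁b - (UnitCocycle.pullback (X ◁ k₀).left c).g a b V h₀a h₀b) +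
        ((UnitCocycle.pullback (X ◁ k₂).left c).g a b V h₂a h₂b -
          (UnitCocycle.pullback (X ◁ k₀).left c).g a b V h₀a h₀b) :=
  UnitCocycle.pullback_g_sub_eq_add_sub_of_forall_appLE (X ◁ ι₀).left (X ◁ k₀).left (X ◁ k₁).left (X ◁ k₂).left
    (X ◁ k₃).left (whiskerLeft_left_comp_eq_of_comp_eq X T₀ T ι₀ hk₁) (whiskerLeft_left_comp_eq_of_comp_eq X T₀ T ι₀ hk₂)
    (whiskerLeft_left_comp_eq_of_comp_eq X T₀ T ι₀ hk₃)
    (appLE_whiskerLeft_sub_eq_add_sub_forall X T₀ T ι₀ k₀ k₁ k₂ k₃ hk₁ hk₂ hk₃ hP₂ hk₀P hk₁P hk₂P hk₃P hψ)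
    c a b V h₀a h₀b h₁a h₁b h₂a h₂b h₃a h₃b


end Forall


end Literature.AlgebraicGeometry.AbelianSchemes.Over

end
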